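import Summits.RiemannHypothesis.RiemannHypothesis.Theorems.JensenPolynomialsFarGumbelJunkSplit
import Summits.RiemannHypothesis.RiemannHypothesis.Theorems.JensenPolynomialsTruncatedBinomialGeom
import Literature.NumberTheory.LFunctions.WangYang2024.PhiEnclosure
import Literature.NumberTheory.LFunctions.DeBruijnPhiLogDerivEnvelope
import Literature.NumberTheory.LFunctions.DeBruijnPhiDecreasing
import Summits.RiemannHypothesis.RiemannHypothesis.Theorems.JensenPolynomialsSkewFarBulk

/-!
# Route `JensenPolynomials`, FAR crux `XiWindowZeroFreeRelFar` (B1-rel far) — line «far-gumbel», stub S2 `stub_junk`, part B: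
POINTWISE bounds for the two junk integrands, region by region (RH-FREE; cell rh-jensen, HUMAN RULING D-0040; helper for item
`stmt-RiemannHypothesis-19465`)

Notation: `N = M − ½`, `a ∈ ℂ` with `‖a‖ ≤ 0.3502·υ²` (`a = farA M s` on the B1 disc), `w = a/u²`, `T_M` the truncated binomial
series (inline, as in `WindowEGF.integralRepr`), `C = binom(M−½, M) ≤ 1`, `Φ ≤ Φ(0) ≤ 0.45`, `Φ(u) ≤ 50e^{9u−πe^{4u}}`.

* §1 geometry: `‖x + z‖ ≤ ‖1 + z‖` (`0 ≤ x ≤ 1`, `‖z‖ ≤ ½`); `‖x + z‖ ≤ ‖1+z‖·(x + r₀)/(1 + r₀)` (`r₀² ≤ x ≤ 1`, `‖z‖ ≤ r₀ ≤ ½`);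
* §2 region R1 `0 < u ≤ 0.4υ`: `Φu^{2M}‖T_M(w)‖ ≤ 0.45·(0.5102υ²)^M` (crude bound);
* §3 region R3a `υ−2 < u ≤ υ`: `Φ(u)·u·‖u²+a‖^N ≤ 50e^{9υ}υ^{2M}‖1+a/υ²‖^N`; region R3b `u > υ`:
  `Φ(u)·u·‖u²+a‖^N ≤ e^{18}e^{−(u−υ)}·e^{9υ}υ^{2M}‖1+a/υ²‖^N` (mode equation `4πe^{4υ}υ = 2M + 9υ`, `e^{4t} ≥ 1+4t+8t²+8t³`).

WHAT THIS IS NOT: elementary real inequalities; nothing here bears on the zeros of `ζ` or the truth of RH.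
References: [GORZPNAS2019]; Wang–Yang 2024 (the `Φ ≤ 50e^{9u−πe^{4u}}` envelope) [WangYang2024]; [CoffeyCsordas2013] (`Φ(0) ≤ 0.45`).
-/

noncomputable section
-- D-0017: `Summit.RiemannHypothesis.RiemannHypothesis.…` duplicates the namespace BY DESIGN (single-problem summit).
set_option linter.dupNamespace false

namespace Summit.RiemannHypothesis.RiemannHypothesis.Theorems.JensenPolynomials.FarGumbel

open Literature.NumberTheory.LFunctions Literature.NumberTheory.LFunctions.WangYang2024 MeasureTheory Set Complex Real
open Summit.RiemannHypothesis.RiemannHypothesis.Theorems.JensenPolynomials.WindowEGF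

/-! ## 1. Geometry of `‖x + z‖` against `‖1 + z‖` -/

/-- For `0 ≤ x ≤ 1` and `‖z‖ ≤ ½`: `‖x + z‖ ≤ ‖1 + z‖`. -/
theorem norm_real_add_le_norm_one_add {x : ℝ} (hx0 : 0 ≤ x) (hx1 : x ≤ 1) {z : ℂ} (hz : ‖z‖ ≤ 1 / 2) :
    ‖(x : ℂ) + z‖ ≤ ‖1 + z‖ := by
  have hre : |z.re| ≤ ‖z‖ := Complex.abs_re_le_norm z
  have hre' := neg_abs_le z.re
  have hsq : ‖(x : ℂ) + z‖ ^ 2 ≤ ‖1 + z‖ ^ 2 := by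
    rw [Complex.sq_norm, Complex.sq_norm, Complex.normSq_apply, Complex.normSq_apply]
    simp only [Complex.add_re, Complex.add_im, Complex.ofReal_re, Complex.ofReal_im, Complex.one_re, Complex.one_im,
      zero_add]
    nlinarith
  exact (pow_le_pow_iff_left₀ (norm_nonneg _) (norm_nonneg _) two_ne_zero).mp hsq

/-- For `r₀² ≤ x ≤ 1`, `‖z‖ ≤ r₀`: `‖x + z‖ ≤ ‖1 + z‖·(x + r₀)/(1 + r₀)` (equality at `z = r₀`). -/
theorem norm_real_add_le_ratio {x r₀ : ℝ} (hr0 : 0 ≤ r₀) (hx0 : r₀ ^ 2 ≤ x) (hx1 : x ≤ 1) {z : ℂ}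
    (hz : ‖z‖ ≤ r₀) : ‖(x : ℂ) + z‖ ≤ ‖1 + z‖ * ((x + r₀) / (1 + r₀)) := by
  have hre : |z.re| ≤ ‖z‖ := Complex.abs_re_le_norm z
  have hc1 : z.re ≤ r₀ := ((le_abs_self _).trans hre).trans hz
  have hq : z.re ^ 2 + z.im ^ 2 ≤ r₀ ^ 2 := by
    have h := Complex.sq_norm z
    rw [Complex.normSq_apply] at h
    nlinarith [norm_nonneg z]
  have h1r : 0 < 1 + r₀ := by linarith
  have hxr : 0 ≤ x + r₀ := by nlinarith
  have hsq : (‖(x : ℂ) + z‖ * (1 + r₀)) ^ 2 ≤ (‖1 + z‖ * (x + r₀)) ^ 2 := by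
    rw [mul_pow, mul_pow, Complex.sq_norm, Complex.sq_norm, Complex.normSq_apply, Complex.normSq_apply]
    simp only [Complex.add_re, Complex.add_im, Complex.ofReal_re, Complex.ofReal_im, Complex.one_re, Complex.one_im,
      zero_add]
    -- RHS − LHS = (1−x)[r₀(2x+r₀+xr₀) − 2c(x−r₀²) − q(1+x+2r₀)] ≥ 0
    have h1x : 0 ≤ 1 - x := by linarith
    have hxr2 : 0 ≤ x - r₀ ^ 2 := by linarith
    nlinarith [mul_nonneg h1x hxr2, mul_nonneg h1x hr0, mul_le_mul_of_nonneg_left hc1 hxr2,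
      mul_le_mul_of_nonneg_left hq (by linarith : (0:ℝ) ≤ 1 + x + 2 * r₀), mul_nonneg h1x (mul_nonneg hr0 hxr)]
  have hlhs : 0 ≤ ‖(x : ℂ) + z‖ * (1 + r₀) := by positivity
  have hrhs : 0 ≤ ‖1 + z‖ * (x + r₀) := by positivity
  have h := (pow_le_pow_iff_left₀ hlhs hrhs two_ne_zero).mp hsq
  rw [mul_div_assoc', le_div_iff₀ h1r]
  exact h

/-! ## 2. Region R1: `0 < u ≤ 0.4υ` (crude bound) -/

/-- `Φ ≤ 0.45` on `[0, ∞)` (indeed everywhere). -/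
theorem deBruijnPhi_le_045 (u : ℝ) : deBruijnPhi u ≤ 0.45 :=
  (deBruijnPhi_le_deBruijnPhi_zero u).trans deBruijnPhi_zero_le

/-- **R1.** For `0 < u`, `u ≤ (2/5)υ` and `‖a‖ ≤ 0.3502υ²`: `Φ(u)u^{2M}‖T_M(a/u²)‖ ≤ 0.45·(0.5102·υ²)^M`. -/
theorem junk_pointwise_R1 (M : ℕ) {υ u : ℝ} {a : ℂ} (hu : 0 < u) (huυ : u ≤ 2 / 5 * υ)
    (ha : ‖a‖ ≤ 0.3502 * υ ^ 2) :
    deBruijnPhi u * u ^ (2 * M) *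
        ‖∑ k ∈ Finset.range (M + 1),
          ((((descPochhammer ℝ k).eval ((M : ℝ) - 1 / 2) / (Nat.factorial k : ℝ) : ℝ)) : ℂ) * (a / (u : ℂ) ^ 2) ^ k‖ ≤
      0.45 * (0.5102 * υ ^ 2) ^ M := by
  have hT := norm_truncBinom_le M (a / (u : ℂ) ^ 2)
  have hΦ := deBruijnPhi_le_045 u
  have hΦ0 := (deBruijnPhi_pos_of_nonneg hu.le).le
  have hw : ‖a / (u : ℂ) ^ 2‖ = ‖a‖ / u ^ 2 := by
    rw [norm_div, norm_pow, Complex.norm_real, Real.norm_of_nonneg hu.le]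
  have hkey : u ^ (2 * M) * (1 + ‖a / (u : ℂ) ^ 2‖) ^ M = (u ^ 2 + ‖a‖) ^ M := by
    rw [hw, pow_mul, ← mul_pow]
    congr 1
    field_simp
  have hbase : u ^ 2 + ‖a‖ ≤ 0.5102 * υ ^ 2 := by nlinarith
  calc deBruijnPhi u * u ^ (2 * M) * _ ≤ deBruijnPhi u * u ^ (2 * M) * (1 + ‖a / (u : ℂ) ^ 2‖) ^ M := by
        apply mul_le_mul_of_nonneg_left hT (mul_nonneg hΦ0 (pow_nonneg hu.le _))
    _ = deBruijnPhi u * (u ^ 2 + ‖a‖) ^ M := by rw [mul_assoc, hkey]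
    _ ≤ 0.45 * (0.5102 * υ ^ 2) ^ M := by
        apply mul_le_mul hΦ (pow_le_pow_left₀ (by positivity) hbase M) (by positivity) (by norm_num)

/-! ## 3. Region R3: `u > υ − 2` — the bulk factor `Φ(u)·u·‖u² + a‖^N` -/

/-- `(υ²)^{N}·υ = υ^{2M}` bookkeeping: `υ·(υ²‖1+z‖)^N = υ^{2M}‖1+z‖^N` (`υ > 0`). -/
theorem mode_pow_bookkeeping {M : ℕ} (hM : 1 ≤ M) {υ : ℝ} (hυ : 0 < υ) (q : ℝ) (hq : 0 ≤ q) :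
    υ * (υ ^ 2 * q) ^ ((M : ℝ) - 1 / 2) = υ ^ (2 * M) * q ^ ((M : ℝ) - 1 / 2) := by
  rw [Real.mul_rpow (by positivity) hq, sq_rpow_halfExp hM hυ.le]
  have : υ * υ ^ (2 * M - 1) = υ ^ (2 * M) := by rw [← pow_succ']; congr 1; omega
  rw [← mul_assoc, this]

/-- **R3a.** For `0 < u ≤ υ` and `‖a‖ ≤ 0.3502υ²`: `Φ(u)·u·‖u²+a‖^{M−½} ≤ 50e^{9υ}υ^{2M}‖1 + a/υ²‖^{M−½}`. -/
theorem junk_pointwise_R3a {M : ℕ} (hM : 1 ≤ M) {υ u : ℝ} {a : ℂ} (hυ : 0 < υ) (hu : 0 < u) (huυ : u ≤ υ)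
    (ha : ‖a‖ ≤ 0.3502 * υ ^ 2) :
    deBruijnPhi u * u * ‖(u : ℂ) ^ 2 + a‖ ^ ((M : ℝ) - 1 / 2) ≤
      50 * Real.exp (9 * υ) * υ ^ (2 * M) * ‖1 + a / (υ : ℂ) ^ 2‖ ^ ((M : ℝ) - 1 / 2) := by
  have hN0 : 0 ≤ (M : ℝ) - 1 / 2 := by
    have : (1:ℝ) ≤ M := by exact_mod_cast hM
    linarith
  have hυ2 : 0 < υ ^ 2 := by positivity
  -- Φ(u) ≤ 50 e^{9u} ≤ 50 e^{9υ}
  have hΦ : deBruijnPhi u ≤ 50 * Real.exp (9 * υ) := by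
    have h := deBruijnPhi_le_fifty hu.le
    have h2 : Real.exp (9 * u - π * Real.exp (4 * u)) ≤ Real.exp (9 * υ) := Real.exp_le_exp.mpr (by nlinarith [pi_pos, Real.exp_pos (4 * u)])
    linarith [mul_le_mul_of_nonneg_left h2 (by norm_num : (0:ℝ) ≤ 50)]
  -- ‖u² + a‖ ≤ υ²‖1 + a/υ²‖
  have hz : ‖a / (υ : ℂ) ^ 2‖ ≤ 1 / 2 := by
    rw [norm_div, norm_pow, Complex.norm_real, Real.norm_of_nonneg hυ.le, div_le_iff₀ hυ2]; linarith
  have hx : ‖(((u ^ 2 / υ ^ 2 : ℝ)) : ℂ) + a / (υ : ℂ) ^ 2‖ ≤ ‖1 + a / (υ : ℂ) ^ 2‖ :=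
    norm_real_add_le_norm_one_add (by positivity) (by rw [div_le_one hυ2]; nlinarith) hz
  have hfac : (u : ℂ) ^ 2 + a = (((υ ^ 2 : ℝ)) : ℂ) * ((((u ^ 2 / υ ^ 2 : ℝ)) : ℂ) + a / (υ : ℂ) ^ 2) := by
    have hυ0 : (υ : ℂ) ≠ 0 := by exact_mod_cast hυ.ne'
    push_cast; field_simp
  have hnorm : ‖(u : ℂ) ^ 2 + a‖ ≤ υ ^ 2 * ‖1 + a / (υ : ℂ) ^ 2‖ := by
    rw [hfac, norm_mul, Complex.norm_real, Real.norm_of_nonneg hυ2.le]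
    exact mul_le_mul_of_nonneg_left hx hυ2.le
  have hpow : ‖(u : ℂ) ^ 2 + a‖ ^ ((M : ℝ) - 1 / 2) ≤ (υ ^ 2 * ‖1 + a / (υ : ℂ) ^ 2‖) ^ ((M : ℝ) - 1 / 2) :=
    Real.rpow_le_rpow (norm_nonneg _) hnorm hN0
  have hΦ0 := (deBruijnPhi_pos_of_nonneg hu.le).le
  calc deBruijnPhi u * u * ‖(u : ℂ) ^ 2 + a‖ ^ ((M : ℝ) - 1 / 2)
      ≤ (50 * Real.exp (9 * υ)) * υ * (υ ^ 2 * ‖1 + a / (υ : ℂ) ^ 2‖) ^ ((M : ℝ) - 1 / 2) := by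
        apply mul_le_mul (mul_le_mul hΦ huυ hu.le (by positivity)) hpow (Real.rpow_nonneg (norm_nonneg _) _)
          (by positivity)
    _ = 50 * Real.exp (9 * υ) * υ ^ (2 * M) * ‖1 + a / (υ : ℂ) ^ 2‖ ^ ((M : ℝ) - 1 / 2) := by
        rw [mul_assoc (50 * Real.exp (9 * υ)), mode_pow_bookkeeping hM hυ _ (norm_nonneg _), ← mul_assoc]

/-- `e^{4t} ≥ 1 + 4t + 8t² + 8t³` for `t ≥ 0` (square of `1 + y + y²/2 ≤ e^y` at `y = 2t`). -/
theorem exp_four_mul_ge {t : ℝ} (ht : 0 ≤ t) : 1 + 4 * t + 8 * t ^ 2 + 8 * t ^ 3 ≤ Real.exp (4 * t) := by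
  have h := Real.quadratic_le_exp_of_nonneg (show (0:ℝ) ≤ 2 * t by linarith)
  have h0 : 0 ≤ 1 + 2 * t + (2 * t) ^ 2 / 2 := by positivity
  have hsq : (1 + 2 * t + (2 * t) ^ 2 / 2) ^ 2 ≤ Real.exp (2 * t) ^ 2 := pow_le_pow_left₀ h0 h 2
  rw [← Real.exp_nat_mul] at hsq
  have : ((2 : ℕ) : ℝ) * (2 * t) = 4 * t := by push_cast; ring
  rw [this] at hsq
  nlinarith [hsq, pow_nonneg ht 4]

/-- From the mode equation: `πe^{4υ} ≥ M/(2υ)` and `M/υ ≥ 10¹⁷`. -/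
theorem mode_consequences (M : ℕ) {υ : ℝ}
    (hυ : (189 / 20 : ℝ) ≤ υ ∧ 4 * π * Real.exp (4 * υ) * υ = 2 * (M : ℝ) + 9 * υ) :
    (M : ℝ) / (2 * υ) ≤ π * Real.exp (4 * υ) ∧ (1e17 : ℝ) ≤ (M : ℝ) / υ := by
  have hυ0 : 0 < υ := by linarith [hυ.1]
  have hE := hυ.2
  constructor
  · rw [div_le_iff₀ (by positivity)]; nlinarith
  · -- `M/υ = 2πe^{4υ} − 9/2 ≥ 2π·e^{37.8} − 4.5`
    have he : (2.6e16 : ℝ) ≤ Real.exp (4 * υ) := by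
      have h378 := (SkewFar.exp_378_bounds).1
      exact h378.trans (Real.exp_le_exp.mpr (by linarith [hυ.1]))
    rw [le_div_iff₀ hυ0]
    have h1 : 3 * (2.6e16 : ℝ) ≤ π * Real.exp (4 * υ) :=
      mul_le_mul Real.pi_gt_three.le he (by norm_num) Real.pi_pos.le
    have h2 : 3 * (2.6e16 : ℝ) * υ ≤ π * Real.exp (4 * υ) * υ := mul_le_mul_of_nonneg_right h1 hυ0.le
    nlinarith [h2, hυ.1]

set_option maxHeartbeats 400000 in
/-- **R3b.** For `u > υ` at the far mode (`4πe^{4υ}υ = 2M + 9υ`, `υ ≥ 189/20`) and `‖a‖ ≤ 0.3502υ²`: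
`Φ(u)·u·‖u²+a‖^{M−½} ≤ e^{18}·e^{−(u−υ)}·e^{9υ}υ^{2M}‖1 + a/υ²‖^{M−½}`. -/
theorem junk_pointwise_R3b {M : ℕ} (hM : 1 ≤ M) {υ u : ℝ} {a : ℂ}
    (hυ : (189 / 20 : ℝ) ≤ υ ∧ 4 * π * Real.exp (4 * υ) * υ = 2 * (M : ℝ) + 9 * υ) (huυ : υ < u)
    (ha : ‖a‖ ≤ 0.3502 * υ ^ 2) :
    deBruijnPhi u * u * ‖(u : ℂ) ^ 2 + a‖ ^ ((M : ℝ) - 1 / 2) ≤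
      Real.exp 18 * Real.exp (-(u - υ)) * (Real.exp (9 * υ) * υ ^ (2 * M) * ‖1 + a / (υ : ℂ) ^ 2‖ ^ ((M : ℝ) - 1 / 2)) := by
  have hυ0 : 0 < υ := by linarith [hυ.1]
  have hu : 0 < u := hυ0.trans huυ
  have hυ2 : 0 < υ ^ 2 := by positivity
  have hN0 : 0 ≤ (M : ℝ) - 1 / 2 := by
    have : (1:ℝ) ≤ M := by exact_mod_cast hM
    linarith
  have hNM : (M : ℝ) - 1 / 2 ≤ M := by linarith
  obtain ⟨hΛ, hm⟩ := mode_consequences M hυ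
  set t : ℝ := u - υ with htdef
  have ht : 0 < t := by rw [htdef]; linarith
  set q : ℝ := ‖1 + a / (υ : ℂ) ^ 2‖ with hqdef
  -- `q ≥ 0.6498`
  have hz : ‖a / (υ : ℂ) ^ 2‖ ≤ 0.3502 := by
    rw [norm_div, norm_pow, Complex.norm_real, Real.norm_of_nonneg hυ0.le, div_le_iff₀ hυ2]; linarith
  have hq : 0.6498 ≤ q := by
    have h := norm_sub_norm_le (1 : ℂ) (-(a / (υ : ℂ) ^ 2))
    rw [sub_neg_eq_add, norm_neg, norm_one] at h
    rw [hqdef]; linarith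
  have hq0 : 0 < q := by linarith
  -- (1) `Φ(u) ≤ 50 e^{9u − πe^{4u}}`
  have hΦ := deBruijnPhi_le_fifty hu.le
  -- (2) `‖u² + a‖ ≤ (u² − υ²) + υ² q ≤ υ² q (1 + 1.539 (u²−υ²)/υ²)`
  have hfac : (υ : ℂ) ^ 2 + a = (((υ ^ 2 : ℝ)) : ℂ) * (1 + a / (υ : ℂ) ^ 2) := by
    have hυc : (υ : ℂ) ≠ 0 := by exact_mod_cast hυ0.ne'
    push_cast; field_simp
  have hnorm1 : ‖(u : ℂ) ^ 2 + a‖ ≤ (u ^ 2 - υ ^ 2) + υ ^ 2 * q := by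
    have hsplit : (u : ℂ) ^ 2 + a = (((u ^ 2 - υ ^ 2 : ℝ)) : ℂ) + ((υ : ℂ) ^ 2 + a) := by push_cast; ring
    calc ‖(u : ℂ) ^ 2 + a‖ = ‖(((u ^ 2 - υ ^ 2 : ℝ)) : ℂ) + ((υ : ℂ) ^ 2 + a)‖ := by rw [hsplit]
      _ ≤ ‖(((u ^ 2 - υ ^ 2 : ℝ)) : ℂ)‖ + ‖(υ : ℂ) ^ 2 + a‖ := norm_add_le _ _
      _ = (u ^ 2 - υ ^ 2) + υ ^ 2 * q := by
          rw [Complex.norm_real, Real.norm_of_nonneg (by nlinarith), hfac, norm_mul, Complex.norm_real,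
            Real.norm_of_nonneg hυ2.le]
  set y : ℝ := (u ^ 2 - υ ^ 2) / (υ ^ 2 * q) with hydef
  have hy0 : 0 ≤ y := by rw [hydef]; apply div_nonneg (by nlinarith) (by positivity)
  have hnorm2 : ‖(u : ℂ) ^ 2 + a‖ ≤ υ ^ 2 * q * (1 + y) := by
    have : υ ^ 2 * q * (1 + y) = (u ^ 2 - υ ^ 2) + υ ^ 2 * q := by rw [hydef]; field_simp; ring
    rw [this]; exact hnorm1
  have hpow : ‖(u : ℂ) ^ 2 + a‖ ^ ((M : ℝ) - 1 / 2) ≤ (υ ^ 2 * q) ^ ((M : ℝ) - 1 / 2) * Real.exp (((M : ℝ) - 1 / 2) * y) := by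
    calc ‖(u : ℂ) ^ 2 + a‖ ^ ((M : ℝ) - 1 / 2) ≤ (υ ^ 2 * q * (1 + y)) ^ ((M : ℝ) - 1 / 2) :=
          Real.rpow_le_rpow (norm_nonneg _) hnorm2 hN0
      _ = (υ ^ 2 * q) ^ ((M : ℝ) - 1 / 2) * (1 + y) ^ ((M : ℝ) - 1 / 2) :=
          Real.mul_rpow (by positivity) (by linarith)
      _ ≤ (υ ^ 2 * q) ^ ((M : ℝ) - 1 / 2) * Real.exp y ^ ((M : ℝ) - 1 / 2) := by
          apply mul_le_mul_of_nonneg_left _ (Real.rpow_nonneg (by positivity) _)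
          exact Real.rpow_le_rpow (by linarith) (by linarith [Real.add_one_le_exp y]) hN0
      _ = (υ ^ 2 * q) ^ ((M : ℝ) - 1 / 2) * Real.exp (((M : ℝ) - 1 / 2) * y) := by
          rw [← Real.exp_mul, mul_comm y]
  -- (3) the exponent: `E = (9u − πe^{4u}) + N y ≤ 9υ + 18 − t − log-free`, via `πe^{4u} = πe^{4υ}e^{4t} ≥ (M/(2υ))(1+4t+8t²+8t³)`
  -- `y ≤ 1.539 (2t/υ + t²/υ²)` and `N ≤ M`
  have hyprod : y * υ ^ 2 ≤ 1.539 * (2 * υ * t + t ^ 2) := by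
    have hyq : y * (υ ^ 2 * q) = u ^ 2 - υ ^ 2 := by rw [hydef]; field_simp
    have hut : u ^ 2 - υ ^ 2 = 2 * υ * t + t ^ 2 := by rw [htdef]; ring
    have h0 : 0 ≤ 2 * υ * t + t ^ 2 := by positivity
    nlinarith [hyq, hut, hq, hy0, hυ2]
  have hexp4 := exp_four_mul_ge ht.le
  have heu : Real.exp (4 * u) = Real.exp (4 * υ) * Real.exp (4 * t) := by rw [← Real.exp_add, htdef]; ring_nf
  -- the master inequality on the exponent
  have hE : (9 * u - π * Real.exp (4 * u)) + ((M : ℝ) - 1 / 2) * y ≤ 9 * υ + 14 - 2 * t := by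
    set m : ℝ := (M : ℝ) / υ with hmdef
    have hMm : (M : ℝ) = m * υ := by rw [hmdef]; field_simp
    have hm0 : 0 ≤ m := by rw [hmdef]; positivity
    -- πe^{4u} ≥ (m/2)(1 + 4t + 8t² + 8t³)
    have h1 : (m / 2) * (1 + 4 * t + 8 * t ^ 2 + 8 * t ^ 3) ≤ π * Real.exp (4 * u) := by
      rw [heu]
      have : m / 2 = (M : ℝ) / (2 * υ) := by rw [hmdef]; field_simp
      rw [this, ← mul_assoc]
      exact mul_le_mul hΛ hexp4 (by positivity) (by positivity)
    -- N·y ≤ m(3.078 t + 0.1629 t²)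
    have h2 : ((M : ℝ) - 1 / 2) * y ≤ m * (3.078 * t + 0.1629 * t ^ 2) := by
      have hy2 : y ≤ 1.539 * (2 * υ * t + t ^ 2) / υ ^ 2 := by rw [le_div_iff₀ hυ2]; exact hyprod
      have hM0 : (0 : ℝ) ≤ M := by positivity
      have hsmall : 1.539 * t ^ 2 / υ ≤ 0.1629 * t ^ 2 := by
        rw [div_le_iff₀ hυ0]
        have hυ1 := hυ.1
        have ht2 : 0 ≤ t ^ 2 := sq_nonneg t
        nlinarith only [hυ1, ht2]
      calc ((M : ℝ) - 1 / 2) * y ≤ (M : ℝ) * y := mul_le_mul_of_nonneg_right hNM hy0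
        _ ≤ (M : ℝ) * (1.539 * (2 * υ * t + t ^ 2) / υ ^ 2) := mul_le_mul_of_nonneg_left hy2 hM0
        _ = m * (3.078 * t + 1.539 * t ^ 2 / υ) := by rw [hmdef]; field_simp; ring
        _ ≤ m * (3.078 * t + 0.1629 * t ^ 2) := by
            apply mul_le_mul_of_nonneg_left _ hm0
            linarith only [hsmall]
    -- polynomial endgame
    have hm17 : (1e17 : ℝ) ≤ m := hm
    have hpoly : 12 * t - 14 ≤ m * (1 / 2 - 1.078 * t + 3.8371 * t ^ 2 + 4 * t ^ 3) := by
      have hquad : 0.424 ≤ 1 / 2 - 1.078 * t + 3.8371 * t ^ 2 := by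
        nlinarith only [sq_nonneg (t - 0.1405), ht.le]
      have ht3 : 0 ≤ t ^ 3 := by positivity
      have hP : 0 ≤ 1 / 2 - 1.078 * t + 3.8371 * t ^ 2 + 4 * t ^ 3 := by linarith only [hquad, ht3]
      rcases le_or_gt t 1 with h1t | h1t
      · have hmP := mul_nonneg hm0 hP
        linarith only [hmP, h1t]
      · have htt : t ≤ t ^ 3 := by
          have ht1 : 1 ≤ t ^ 2 := by nlinarith only [h1t]
          calc t = t * 1 := by ring
            _ ≤ t * t ^ 2 := mul_le_mul_of_nonneg_left ht1 ht.le
            _ = t ^ 3 := by ring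
        have h4 : 4 * t ^ 3 ≤ 1 / 2 - 1.078 * t + 3.8371 * t ^ 2 + 4 * t ^ 3 := by linarith only [hquad]
        have h5 : m * (4 * t ^ 3) ≤ m * (1 / 2 - 1.078 * t + 3.8371 * t ^ 2 + 4 * t ^ 3) :=
          mul_le_mul_of_nonneg_left h4 hm0
        have h6 : 3 * (4 * t ^ 3) ≤ m * (4 * t ^ 3) :=
          mul_le_mul_of_nonneg_right (by linarith only [hm17]) (by positivity)
        linarith only [htt, h5, h6, h1t]
    have hid : m * (1 / 2 - 1.078 * t + 3.8371 * t ^ 2 + 4 * t ^ 3) =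
        (m / 2) * (1 + 4 * t + 8 * t ^ 2 + 8 * t ^ 3) - m * (3.078 * t + 0.1629 * t ^ 2) := by ring
    have hu9 : 9 * u = 9 * υ + 9 * t := by rw [htdef]; ring
    linarith only [h1, h2, hpoly, hid, hu9, ht.le]
  -- (4) assemble
  have hΦ0 := (deBruijnPhi_pos_of_nonneg hu.le).le
  have huυ' : u ≤ υ * Real.exp t := by
    have : 1 + t ≤ Real.exp t := by linarith [Real.add_one_le_exp t]
    have hu1 : u = υ + t := by rw [htdef]; ring
    rw [hu1]; nlinarith [hυ.1]
  have hbook := mode_pow_bookkeeping hM hυ0 q hq0.le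
  calc deBruijnPhi u * u * ‖(u : ℂ) ^ 2 + a‖ ^ ((M : ℝ) - 1 / 2)
      ≤ (50 * Real.exp (9 * u - π * Real.exp (4 * u))) * (υ * Real.exp t) *
          ((υ ^ 2 * q) ^ ((M : ℝ) - 1 / 2) * Real.exp (((M : ℝ) - 1 / 2) * y)) := by
        apply mul_le_mul (mul_le_mul hΦ huυ' hu.le (by positivity)) hpow (Real.rpow_nonneg (norm_nonneg _) _)
          (by positivity)
    _ = 50 * (Real.exp ((9 * u - π * Real.exp (4 * u)) + ((M : ℝ) - 1 / 2) * y) * Real.exp t) *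
          (υ * (υ ^ 2 * q) ^ ((M : ℝ) - 1 / 2)) := by rw [Real.exp_add]; ring
    _ ≤ 50 * (Real.exp (9 * υ + 14 - 2 * t) * Real.exp t) * (υ * (υ ^ 2 * q) ^ ((M : ℝ) - 1 / 2)) := by
        gcongr
    _ = (50 * Real.exp 14) * Real.exp (-t) * (Real.exp (9 * υ) * υ ^ (2 * M) * q ^ ((M : ℝ) - 1 / 2)) := by
        have hexp : Real.exp (9 * υ + 14 - 2 * t) * Real.exp t = Real.exp 14 * Real.exp (-t) * Real.exp (9 * υ) := by
          rw [← Real.exp_add, ← Real.exp_add, ← Real.exp_add]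
          congr 1; ring
        rw [hexp, hbook]
        ring
    _ ≤ Real.exp 18 * Real.exp (-(u - υ)) * (Real.exp (9 * υ) * υ ^ (2 * M) * q ^ ((M : ℝ) - 1 / 2)) := by
        have h50 : 50 * Real.exp 14 ≤ Real.exp 18 := by
          have h1 := Real.exp_one_gt_d9
          have h2 : (7.29 : ℝ) ≤ Real.exp 2 := by
            have : Real.exp 2 = Real.exp 1 * Real.exp 1 := by rw [← Real.exp_add]; norm_num
            rw [this]; nlinarith only [h1]
          have h4 : (50 : ℝ) ≤ Real.exp 4 := by
            have : Real.exp 4 = Real.exp 2 * Real.exp 2 := by rw [← Real.exp_add]; norm_num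
            rw [this]; nlinarith only [h2]
          calc 50 * Real.exp 14 ≤ Real.exp 4 * Real.exp 14 := by gcongr
            _ = Real.exp 18 := by rw [← Real.exp_add]; norm_num
        rw [htdef]
        gcongr

/-! ## 4. The size of `‖1 + a/υ²‖` -/

/-- `‖1 + a/υ²‖ ≥ 0.6498` when `‖a‖ ≤ 0.3502υ²` (`υ > 0`): the lower edge of the disc `‖z̃‖ ≤ 0.3502` used by R3b and by the
`stub_junk` assembly. -/
theorem norm_one_add_div_sq_ge {υ : ℝ} (hυ : 0 < υ) {a : ℂ} (ha : ‖a‖ ≤ 0.3502 * υ ^ 2) :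
    0.6498 ≤ ‖1 + a / (υ : ℂ) ^ 2‖ := by
  have hυ2 : 0 < υ ^ 2 := by positivity
  have hz : ‖a / (υ : ℂ) ^ 2‖ ≤ 0.3502 := by
    rw [norm_div, norm_pow, Complex.norm_real, Real.norm_of_nonneg hυ.le, div_le_iff₀ hυ2]; linarith
  have h := norm_sub_norm_le (1 : ℂ) (-(a / (υ : ℂ) ^ 2))
  rw [sub_neg_eq_add, norm_neg, norm_one] at h
  linarith

end Summit.RiemannHypothesis.RiemannHypothesis.Theorems.JensenPolynomials.FarGumbel
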